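import Summits.ResolutionOfSingularities.ResolutionOfSingularities.Theorems.WeightedInvariantIotaLex
import Summits.ResolutionOfSingularities.ResolutionOfSingularities.Theorems.WeightedInvariantContactCentreFiltrationBasic
import HarnessLib

/-!
# The flag-slope letters `σ` of the P3 candidate `ι₃ = (ν ; ε ; σ)` — TYPED (ORDER (o32-ι-b) of res-L1-w43-plan-1)
# (door `HypersurfaceCentreConstruction`, stmt-ResolutionOfSingularities-19897, KEY `stub_localWeightedDropEFT4S`, rung P3)

Topic: `Summits/ResolutionOfSingularities/ResolutionOfSingularities/Theorems`. Helper for the door item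
`HypersurfaceCentreConstruction` (statement `stmt-ResolutionOfSingularities-19897`, route `WeightedInvariant`), line
`local-engine` of res-L1-w43-plan-1 (L W4.3), ORDER (o32-ι) «P3 LETTERS, TYPED» (DEALS gen 10 #6, HOME/STATUS
2026-08-27T11:00:43Z), σ side = (T1)+(T2) of res-type-073's design input `plan/tools/res-type-073/p3/IOTA3-PROBE.md`
(v1.1, sha16 b01ef292ac4d75ba). Typer res-type-073.

[OURS · L1 W4.3] Replaces the role of NO printed item; NOT a statement of the manuscript under review
(Hironaka 2017, [claim: Hironaka2017, status: under-review]). AI work, weaker than expert review. DEFINITIONS of candidate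
letters + transport lemmas only: nothing here asserts (strat), (drop), semicontinuity or any clause of the KEY for these
letters; the P3 rung is registered in the ∃-form (`stub_keyRung_dimLEThree`, skeleton v3.7) precisely because no pair is
claimed.

## The objects (every local ring; junk off local rings, as `iotaOrd` / `bMax`)
* `flagContactFiltration g₁ g₂ q r₁ r₂ n = ⨆_{α β} (g₁^α g₂^β)·𝔪^⌈(n − r₁α − r₂β)/q⌉` — the RATIONAL TWO-FLAG contact filtration
  («monomials `u^γ g₁^α g₂^β` with `|γ| + (r₁/q)α + (r₂/q)β ≥ n/q`», written without complementary parameters: choice-free,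
  (R5)); `q = 1`, `g₂` of weight `1`: = 092's `contactFiltration g₁ r₁` (p514802; bridge `flagContactFiltration_one_eq_contactFiltration`).
* `IsTwoFlag g₁ g₂` (independent residues in `𝔪/𝔪²`), `FlagReaches f ν q r₁ r₂` (SOME two-flag carries `f` to level `r₁ν`) —
  the sups below run over ALL flags, never a derivative-defined «maximal contact» (IOTA3-PROBE §3 (4)).
* LETTERS (R6) = Abramovich–Temkin–Włodarczyk's `(a₂, a₃)` MAXIMISED OVER FLAGS, scaled to naturals: `sigmaRatioNat f`
  (`= ν!·a₂/a₁`, `ν = ord f`; junk `0` if unbounded) and `sigmaLevelNat f` (`= D·a₃/a₁` among the ratio-maximisers,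
  `D = levelScale ν σ₁`); ORDINAL letters `iotaSigmaRatio` (`< ω`) and `iotaSigmaLevel` (`≤ ω`: **`ω` = TOP when the level set
  is unbounded or empty** — cylinder points, dimension ≤ 2, pure powers; res-L1-w43-plan-1 RESHAPE 11:25:23Z / IOTA3-DESIGN v1
  §2.3, the Bierstone–Milman/ATW `∞`-convention: a curve situation sits ABOVE its isolated refinements); `iotaSigma :=
  iotaLex (ω+1) iotaSigmaRatio iotaSigmaLevel` (`< (ω+1)·ω`); nesting `iotaFlatOf ιε := iotaLex ((ω+1)·ω) ιε iotaSigma` for any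
  first block `ιε` (ORDER (o32-ι-a): res-type-013's `Iota3.iotaOrdEps`, p527087). Hand calibration (IOTA3-PROBE §7): E8
  `z²+y³+x⁷ → (2,3,7)`, Hauser `x²+y⁷+yz⁴/𝔽₂ → (2,5,5)`, 078's E2 `x³+y⁴z⁴+y⁷ → (3;7,28/3)`, `A₄ → (2,2,5)` = ATW on all four.
* TRANSPORT ((T2)): every object is invariant under ring isomorphisms and under `f ↦ v·f` (`v` a unit) ⇒ (c6)/(c12a) shapes
  `iotaSigma_isoInvariant` / `_unitInvariant`, `iotaFlatOf_isoInvariant` / `_unitInvariant` (transfer kit `iotaLex_*`, p504861).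

DESIGN NOTES. (R5) triples `(q; r₁, r₂)`, `1 ≤ q ≤ r₂ ≤ r₁`, encode the weights `(r₁/q, r₂/q) ≥ 1` on the flag and `1` on `𝔪`;
`⌈·/q⌉ = (· + q − 1)/q` on `ℕ` (exponent `0` past the level). (R6) EXACTNESS: `a₂/a₁ ∈ (1/d)ℕ`, `d ≤ ν`, so `ν!` clears it; the
denominators of `a₃/a₁` are bounded in terms of `(ν, a₂)` — `levelScale` is a generous factorial; that the floors lose nothing is
an OBLIGATION (with the (O-c7/c8) package), used nowhere here. (R7) NOT in this file: ε (p527087), the cylinder-wise reading of σ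
when ε = 0 ((o32-ι-c), via 061's/005's `ContactCylinder` combinators), and every clause statement.

## References
* D. Abramovich, M. Temkin, J. Włodarczyk, *Functorial embedded resolution via weighted blowings up*, Algebra & Number Theory 18
  (2024), §5 (invariant `(a₁,…,aₙ)`, centre `(x₁^{a₁},…,xₙ^{aₙ})`) [ATW2024]; H. Hironaka, *Characteristic polyhedra of
  singularities*, J. Math. Kyoto Univ. 7 (1967) [Hironaka1967]; res-L1-w43-plan-1 DEALS gen 10 #1/#3/#6, res-type-073
  IOTA3-PROBE v1.1, res-type-078 IOTA3-INPUT (OURS, AI planning).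
-/

noncomputable section

open IsLocalRing Literature.AlgebraicGeometry.Resolution

set_option linter.dupNamespace false -- mandated namespace of this single-conjunct summit

namespace Summit.ResolutionOfSingularities.ResolutionOfSingularities.Cruxes.HypersurfaceCentreConstruction.LocalEngine

namespace Iota3

universe u

variable {S : Type u} [CommRing S]

/-! ## The two-flag rational contact filtration -/

/-- [OURS · (o32-ι-b)] **The two-flag rational contact filtration**: degree `n` is
`⨆_{α β} (g₁^α g₂^β) · 𝔪^⌈(n − r₁α − r₂β)/q⌉` — the monomials `u^γ g₁^α g₂^β` of weighted degree `|γ| + (r₁/q)α + (r₂/q)β ≥ n/q`,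
written without the complementary parameters (choice-free).  [cite: Hironaka1967, §1] -/
def flagContactFiltration [IsLocalRing S] (g₁ g₂ : S) (q r₁ r₂ n : ℕ) : Ideal S :=
  ⨆ α : ℕ, ⨆ β : ℕ, Ideal.span {g₁ ^ α * g₂ ^ β} * maximalIdeal S ^ ((n - r₁ * α - r₂ * β + q - 1) / q)

/-- The `rfl` unfolding. [folklore] -/
theorem flagContactFiltration_def [IsLocalRing S] (g₁ g₂ : S) (q r₁ r₂ n : ℕ) :
    flagContactFiltration g₁ g₂ q r₁ r₂ n =
      ⨆ α : ℕ, ⨆ β : ℕ, Ideal.span {g₁ ^ α * g₂ ^ β} * maximalIdeal S ^ ((n - r₁ * α - r₂ * β + q - 1) / q) := rfl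

/-- With `q = 1` and `g₂ ∈ 𝔪` of weight `1` the two-flag filtration lies in 092's `contactFiltration g₁ r₁`. [folklore] -/
theorem flagContactFiltration_le_contactFiltration [IsLocalRing S] {g₁ g₂ : S} (hg₂ : g₂ ∈ maximalIdeal S)
    (r₁ n : ℕ) : flagContactFiltration g₁ g₂ 1 r₁ 1 n ≤ contactFiltration g₁ r₁ n := by
  rw [flagContactFiltration_def, contactFiltration_def]
  refine iSup_le fun α => iSup_le fun β => le_iSup_of_le α ?_
  have hpow : g₂ ^ β ∈ maximalIdeal S ^ β := Ideal.pow_mem_pow hg₂ β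
  calc Ideal.span {g₁ ^ α * g₂ ^ β} * maximalIdeal S ^ ((n - r₁ * α - 1 * β + 1 - 1) / 1)
      = Ideal.span {g₁ ^ α} * (Ideal.span {g₂ ^ β} * maximalIdeal S ^ (n - r₁ * α - β)) := by
        rw [one_mul, Nat.add_sub_cancel, Nat.div_one, ← Ideal.span_singleton_mul_span_singleton, mul_assoc]
    _ ≤ Ideal.span {g₁ ^ α} * (maximalIdeal S ^ β * maximalIdeal S ^ (n - r₁ * α - β)) :=
        Ideal.mul_mono_right (Ideal.mul_mono_left ((Ideal.span_singleton_le_iff_mem _).mpr hpow))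
    _ ≤ Ideal.span {g₁ ^ α} * maximalIdeal S ^ (n - r₁ * α) := by
        refine Ideal.mul_mono_right ?_
        rw [← pow_add]
        exact Ideal.pow_le_pow_right (by omega)

/-- Conversely the one-flag integer filtration sits inside the two-flag one (take `β = 0`). [folklore] -/
theorem contactFiltration_le_flagContactFiltration [IsLocalRing S] (g₁ g₂ : S) (r₁ n : ℕ) :
    contactFiltration g₁ r₁ n ≤ flagContactFiltration g₁ g₂ 1 r₁ 1 n := by
  rw [flagContactFiltration_def, contactFiltration_def]
  refine iSup_le fun α => le_iSup_of_le α (le_iSup_of_le 0 ?_)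
  rw [pow_zero, mul_one, Nat.mul_zero, Nat.sub_zero, Nat.add_sub_cancel, Nat.div_one]

/-- **Bridge to 092's `contactFiltration`**: `flagContactFiltration g₁ g₂ 1 r₁ 1 n = contactFiltration g₁ r₁ n` for `g₂ ∈ 𝔪`.
[folklore] -/
theorem flagContactFiltration_one_eq_contactFiltration [IsLocalRing S] {g₁ g₂ : S} (hg₂ : g₂ ∈ maximalIdeal S)
    (r₁ n : ℕ) : flagContactFiltration g₁ g₂ 1 r₁ 1 n = contactFiltration g₁ r₁ n :=
  le_antisymm (flagContactFiltration_le_contactFiltration hg₂ r₁ n) (contactFiltration_le_flagContactFiltration g₁ g₂ r₁ n)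

/-! ## Flags and reached weights -/

/-- [OURS · (o32-ι-b)] `(g₁, g₂)` is a **two-flag**: both in `𝔪`, residues independent in `𝔪/𝔪²` (elementary form:
`a g₁ + b g₂ ∈ 𝔪²` forces `a, b ∈ 𝔪`); a predicate of the line, not a cited statement. -/
def IsTwoFlag [IsLocalRing S] (g₁ g₂ : S) : Prop :=
  g₁ ∈ maximalIdeal S ∧ g₂ ∈ maximalIdeal S ∧
    ∀ a b : S, a * g₁ + b * g₂ ∈ maximalIdeal S ^ 2 → a ∈ maximalIdeal S ∧ b ∈ maximalIdeal S

/-- A two-flag member is a regular parameter: `g₁ ∉ 𝔪²`. [folklore] -/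
theorem IsTwoFlag.left_not_mem_sq [IsLocalRing S] {g₁ g₂ : S} (h : IsTwoFlag g₁ g₂) : g₁ ∉ maximalIdeal S ^ 2 := by
  intro h1
  have := (h.2.2 1 0 (by rwa [one_mul, zero_mul, add_zero])).1
  exact (IsLocalRing.maximalIdeal.isMaximal S).ne_top (Ideal.eq_top_of_isUnit_mem _ this isUnit_one)

/-- [OURS · (o32-ι-b)] `f` (of order `ν`) **reaches the weights `(r₁/q, r₂/q)`**: some two-flag carries `f` to level `r₁ν`
(the weighted degree of `g₁^ν`) of its `(q; r₁, r₂)`-filtration.  The sup in the letters runs over ALL flags; a predicate of the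
line, not a cited statement. -/
def FlagReaches [IsLocalRing S] (f : S) (ν q r₁ r₂ : ℕ) : Prop :=
  ∃ g₁ g₂ : S, IsTwoFlag g₁ g₂ ∧ f ∈ flagContactFiltration g₁ g₂ q r₁ r₂ (r₁ * ν)

/-- Admissible weight triples: `1 ≤ q ≤ r₂ ≤ r₁` (weights `r₁/q ≥ r₂/q ≥ 1`); a predicate of the line, not a cited statement. -/
def AdmissibleTriple (q r₁ r₂ : ℕ) : Prop := 0 < q ∧ q ≤ r₂ ∧ r₂ ≤ r₁

/-! ## The letters -/

/-- The scale clearing the denominators of the ratio letter: `ν!` (design note (R6)). -/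
def ratioScale (ν : ℕ) : ℕ := Nat.factorial ν

/-- A (generous) scale for the level letter given `ν` and the scaled ratio `s`: `(ν·(s+1)+1)!` (design note (R6); exactness
is an obligation, not used here). -/
def levelScale (ν s : ℕ) : ℕ := Nat.factorial (ν * (s + 1) + 1)

/-- [OURS · (o32-ι-b)] The scaled **ratio letter** `σ₁ = ν!·sup {r₁/r₂ : admissible triple reached}` (`= ν!·a₂/a₁` of
Abramovich–Temkin–Włodarczyk, maximised over flags); junk `0` when the set is unbounded (pure powers) — `Nat.sSup`. -/
def sigmaRatioNat [IsLocalRing S] (f : S) : ℕ :=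
  sSup {m : ℕ | ∃ q r₁ r₂ : ℕ, AdmissibleTriple q r₁ r₂ ∧ FlagReaches f (adicOrder f).toNat q r₁ r₂ ∧
    m * r₂ ≤ ratioScale (adicOrder f).toNat * r₁}

/-- [OURS · (o32-ι-b)] The **level set**: scaled levels `m` (`m·q ≤ D·r₁`, `D = levelScale ν σ₁`) of admissible triples
reaching THE MAXIMAL RATIO (`ν!·r₁ = σ₁·r₂`). Empty when no flag exists or the ratio is junk; unbounded at cylinder points /
dimension ≤ 2 («nothing left behind the flag»). -/
def levelSet [IsLocalRing S] (f : S) : Set ℕ :=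
  {m : ℕ | ∃ q r₁ r₂ : ℕ, AdmissibleTriple q r₁ r₂ ∧ FlagReaches f (adicOrder f).toNat q r₁ r₂ ∧
    ratioScale (adicOrder f).toNat * r₁ = sigmaRatioNat f * r₂ ∧
    m * q ≤ levelScale (adicOrder f).toNat (sigmaRatioNat f) * r₁}

/-- [OURS · (o32-ι-b)] The scaled **level letter, finite part** `σ₂ = D·sup {r₁/q : admissible triple reached AT THE MAXIMAL
RATIO}` (`= D·a₃/a₁`) as a natural number (`Nat.sSup`: `0` when the level set is empty or unbounded — the ORDINAL letter
`iotaSigmaLevel` below replaces that junk by `ω`). -/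
def sigmaLevelNat [IsLocalRing S] (f : S) : ℕ := sSup (levelSet f)

open Classical in
/-- [OURS · (o32-ι-b)] The ratio letter as an `Ordinal`-valued class function (`0` off local rings, as `iotaOrd`). -/
def iotaSigmaRatio (R : Type) [CommRing R] (f : R) : Ordinal.{0} :=
  if h : IsLocalRing R then ((@sigmaRatioNat R _ h f : ℕ) : Ordinal.{0}) else 0

open Classical in
/-- [OURS · (o32-ι-b)] The level letter as an `Ordinal`-valued class function: the finite scaled level when the level set is
non-empty and bounded, **`ω` (TOP) otherwise** (res-L1-w43-plan-1 RESHAPE 2026-08-27T11:25:23Z: «no third parameter / level set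
unbounded must read TOP» — a curve situation sits above its isolated refinements); `0` off local rings (junk). -/
def iotaSigmaLevel (R : Type) [CommRing R] (f : R) : Ordinal.{0} :=
  if h : IsLocalRing R then
    (if BddAbove (@levelSet R _ h f) ∧ (@levelSet R _ h f).Nonempty then ((@sigmaLevelNat R _ h f : ℕ) : Ordinal.{0})
      else Ordinal.omega0)
  else 0

/-- [OURS · (o32-ι-b)] **σ = (σ₁, σ₂) lexicographic**: `iotaSigma = (ω+1)·σ₁ + σ₂` (073's `iotaLex`, p504861; base `ω+1` since the
level letter takes the value `ω`). -/
def iotaSigma : (R : Type) → [CommRing R] → R → Ordinal.{0} :=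
  iotaLex (Ordinal.omega0 + 1) iotaSigmaRatio iotaSigmaLevel

/-- [OURS · (o32-ι-b)] The nesting with ANY first block `ιε` (ORDER (o32-ι-a): res-type-013's `iotaOrdEps = (ν, ε)`):
`iotaFlatOf ιε = ((ω+1)·ω)·ιε + σ`. -/
def iotaFlatOf (ιε : (R : Type) → [CommRing R] → R → Ordinal.{0}) : (R : Type) → [CommRing R] → R → Ordinal.{0} :=
  iotaLex ((Ordinal.omega0 + 1) * Ordinal.omega0) ιε iotaSigma

/-! ## Unfolding and bounds -/

/-- On a local ring `iotaSigmaRatio R f = sigmaRatioNat f`. [folklore] -/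
theorem iotaSigmaRatio_eq (R : Type) [CommRing R] [h : IsLocalRing R] (f : R) :
    iotaSigmaRatio R f = (sigmaRatioNat f : ℕ) := by unfold iotaSigmaRatio; rw [dif_pos h]

/-- Off local rings `iotaSigmaRatio R f = 0` (junk). [folklore] -/
theorem iotaSigmaRatio_of_not_isLocalRing (R : Type) [CommRing R] (h : ¬ IsLocalRing R) (f : R) :
    iotaSigmaRatio R f = 0 := by unfold iotaSigmaRatio; rw [dif_neg h]

/-- On a local ring with non-empty bounded level set, `iotaSigmaLevel R f = sigmaLevelNat f`. [folklore] -/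
theorem iotaSigmaLevel_eq (R : Type) [CommRing R] [h : IsLocalRing R] (f : R)
    (hb : BddAbove (levelSet f) ∧ (levelSet f).Nonempty) : iotaSigmaLevel R f = (sigmaLevelNat f : ℕ) := by
  unfold iotaSigmaLevel; rw [dif_pos h, if_pos hb]

/-- On a local ring with empty or unbounded level set, `iotaSigmaLevel R f = ω` (TOP). [folklore] -/
theorem iotaSigmaLevel_eq_omega0 (R : Type) [CommRing R] [h : IsLocalRing R] (f : R)
    (hb : ¬ (BddAbove (levelSet f) ∧ (levelSet f).Nonempty)) : iotaSigmaLevel R f = Ordinal.omega0 := by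
  unfold iotaSigmaLevel; rw [dif_pos h, if_neg hb]

/-- On a local ring `iotaSigmaLevel R f ≤ ω`. [folklore] -/
theorem iotaSigmaLevel_le_omega0 (R : Type) [CommRing R] [IsLocalRing R] (f : R) :
    iotaSigmaLevel R f ≤ Ordinal.omega0 := by
  by_cases hb : BddAbove (levelSet f) ∧ (levelSet f).Nonempty
  · rw [iotaSigmaLevel_eq R f hb]; exact (Ordinal.natCast_lt_omega0 _).le
  · rw [iotaSigmaLevel_eq_omega0 R f hb]

/-- Off local rings `iotaSigmaLevel R f = 0` (junk). [folklore] -/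
theorem iotaSigmaLevel_of_not_isLocalRing (R : Type) [CommRing R] (h : ¬ IsLocalRing R) (f : R) :
    iotaSigmaLevel R f = 0 := by unfold iotaSigmaLevel; rw [dif_neg h]

/-- `σ₁ < ω`. -/
theorem iotaSigmaRatio_boundedBy : IotaBoundedBy Ordinal.omega0 iotaSigmaRatio := by
  intro R _ f
  by_cases h : IsLocalRing R
  · rw [iotaSigmaRatio_eq]; exact Ordinal.natCast_lt_omega0 _
  · rw [iotaSigmaRatio_of_not_isLocalRing R h]; exact Ordinal.omega0_pos

/-- `σ₂ < ω + 1` (i.e. `≤ ω`). -/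
theorem iotaSigmaLevel_boundedBy : IotaBoundedBy (Ordinal.omega0 + 1) iotaSigmaLevel := by
  intro R _ f
  by_cases h : IsLocalRing R
  · exact Order.lt_add_one_iff.2 (iotaSigmaLevel_le_omega0 R f)
  · rw [iotaSigmaLevel_of_not_isLocalRing R h]; exact Order.lt_add_one_iff.2 Ordinal.omega0_pos.le

/-- `σ < (ω+1)·ω`. -/
theorem iotaSigma_boundedBy : IotaBoundedBy ((Ordinal.omega0 + 1) * Ordinal.omega0) iotaSigma :=
  iotaLex_boundedBy iotaSigmaRatio_boundedBy iotaSigmaLevel_boundedBy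

/-! ## Transport along ring isomorphisms ((c6) shape) -/

section Equiv

variable {T : Type u} [CommRing T] [IsLocalRing S] [IsLocalRing T]

/-- A ring isomorphism transports the two-flag filtration. [folklore] -/
theorem map_flagContactFiltration_ringEquiv (e : S ≃+* T) (g₁ g₂ : S) (q r₁ r₂ n : ℕ) :
    (flagContactFiltration g₁ g₂ q r₁ r₂ n).map e = flagContactFiltration (e g₁) (e g₂) q r₁ r₂ n := by
  rw [flagContactFiltration_def, flagContactFiltration_def, Ideal.map_iSup]
  refine iSup_congr fun α => ?_
  rw [Ideal.map_iSup]
  refine iSup_congr fun β => ?_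
  rw [Ideal.map_mul, Ideal.map_pow, Ideal.map_span, Set.image_singleton, map_ringEquiv_maximalIdeal e, map_mul,
    map_pow, map_pow]

/-- `e f ∈ flagContactFiltration (e g₁) (e g₂) … ↔ f ∈ flagContactFiltration g₁ g₂ …`. [folklore] -/
theorem apply_mem_flagContactFiltration_iff (e : S ≃+* T) (f g₁ g₂ : S) (q r₁ r₂ n : ℕ) :
    e f ∈ flagContactFiltration (e g₁) (e g₂) q r₁ r₂ n ↔ f ∈ flagContactFiltration g₁ g₂ q r₁ r₂ n := by
  rw [← map_flagContactFiltration_ringEquiv, Ideal.apply_mem_of_equiv_iff]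

/-- Two-flags are transported by ring isomorphisms. [folklore] -/
theorem IsTwoFlag.map_ringEquiv {g₁ g₂ : S} (h : IsTwoFlag g₁ g₂) (e : S ≃+* T) : IsTwoFlag (e g₁) (e g₂) := by
  refine ⟨(apply_mem_maximalIdeal_iff e g₁).mpr h.1, (apply_mem_maximalIdeal_iff e g₂).mpr h.2.1, fun a b hab => ?_⟩
  have hab' : e (e.symm a * g₁ + e.symm b * g₂) ∈ maximalIdeal T ^ 2 := by
    rwa [map_add, map_mul, map_mul, e.apply_symm_apply, e.apply_symm_apply]
  rw [apply_mem_maximalIdeal_pow_iff] at hab'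
  obtain ⟨ha, hb⟩ := h.2.2 _ _ hab'
  refine ⟨?_, ?_⟩
  · have := (apply_mem_maximalIdeal_iff e (e.symm a)).mpr ha
    rwa [e.apply_symm_apply] at this
  · have := (apply_mem_maximalIdeal_iff e (e.symm b)).mpr hb
    rwa [e.apply_symm_apply] at this

/-- `IsTwoFlag (e g₁) (e g₂) ↔ IsTwoFlag g₁ g₂`. [folklore] -/
theorem isTwoFlag_ringEquiv_iff (e : S ≃+* T) (g₁ g₂ : S) : IsTwoFlag (e g₁) (e g₂) ↔ IsTwoFlag g₁ g₂ := by
  refine ⟨fun h => ?_, fun h => h.map_ringEquiv e⟩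
  have h' := h.map_ringEquiv e.symm
  rwa [e.symm_apply_apply, e.symm_apply_apply] at h'

/-- `FlagReaches` is invariant under ring isomorphisms. [folklore] -/
theorem flagReaches_ringEquiv_iff (e : S ≃+* T) (f : S) (ν q r₁ r₂ : ℕ) :
    FlagReaches (e f) ν q r₁ r₂ ↔ FlagReaches f ν q r₁ r₂ := by
  constructor
  · rintro ⟨g₁', g₂', hfl, hmem⟩
    refine ⟨e.symm g₁', e.symm g₂', (isTwoFlag_ringEquiv_iff e _ _).mp ?_,
      (apply_mem_flagContactFiltration_iff e f (e.symm g₁') (e.symm g₂') q r₁ r₂ (r₁ * ν)).mp ?_⟩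
    · rwa [e.apply_symm_apply, e.apply_symm_apply]
    · rwa [e.apply_symm_apply, e.apply_symm_apply]
  · rintro ⟨g₁, g₂, hfl, hmem⟩
    exact ⟨e g₁, e g₂, hfl.map_ringEquiv e, (apply_mem_flagContactFiltration_iff e f g₁ g₂ q r₁ r₂ (r₁ * ν)).mpr hmem⟩

/-- `σ₁` is invariant under ring isomorphisms. [folklore] -/
theorem sigmaRatioNat_ringEquiv (e : S ≃+* T) (f : S) : sigmaRatioNat (e f) = sigmaRatioNat f := by
  simp only [sigmaRatioNat, adicOrder_map_ringEquiv, flagReaches_ringEquiv_iff]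

/-- The level set is invariant under ring isomorphisms. [folklore] -/
theorem levelSet_ringEquiv (e : S ≃+* T) (f : S) : levelSet (e f) = levelSet f := by
  simp only [levelSet, adicOrder_map_ringEquiv, flagReaches_ringEquiv_iff, sigmaRatioNat_ringEquiv]

/-- `σ₂` (finite part) is invariant under ring isomorphisms. [folklore] -/
theorem sigmaLevelNat_ringEquiv (e : S ≃+* T) (f : S) : sigmaLevelNat (e f) = sigmaLevelNat f := by
  rw [sigmaLevelNat, sigmaLevelNat, levelSet_ringEquiv]

end Equiv

/-! ## Unit invariance ((c12a) shape) -/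

section Unit

variable [IsLocalRing S]

/-- `FlagReaches (v f) … ↔ FlagReaches f …` for a unit `v`. [folklore] -/
theorem flagReaches_unit_mul_iff {v : S} (hv : IsUnit v) (f : S) (ν q r₁ r₂ : ℕ) :
    FlagReaches (v * f) ν q r₁ r₂ ↔ FlagReaches f ν q r₁ r₂ := by
  unfold FlagReaches
  simp only [Ideal.unit_mul_mem_iff_mem _ hv]

/-- `σ₁ (v f) = σ₁ f` for a unit `v`. [folklore] -/
theorem sigmaRatioNat_unit_mul {v : S} (hv : IsUnit v) (f : S) : sigmaRatioNat (v * f) = sigmaRatioNat f := by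
  simp only [sigmaRatioNat, adicOrder_unit_mul_left hv, flagReaches_unit_mul_iff hv]

/-- The level set is invariant under `f ↦ v f`, `v` a unit. [folklore] -/
theorem levelSet_unit_mul {v : S} (hv : IsUnit v) (f : S) : levelSet (v * f) = levelSet f := by
  simp only [levelSet, adicOrder_unit_mul_left hv, flagReaches_unit_mul_iff hv, sigmaRatioNat_unit_mul hv]

/-- `σ₂ (v f) = σ₂ f` for a unit `v`. [folklore] -/
theorem sigmaLevelNat_unit_mul {v : S} (hv : IsUnit v) (f : S) : sigmaLevelNat (v * f) = sigmaLevelNat f := by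
  rw [sigmaLevelNat, sigmaLevelNat, levelSet_unit_mul hv]

end Unit

/-! ## The clause shapes (c6), (c12a) for the letters and for the nesting -/

/-- (c6) for `σ₁`. -/
theorem iotaSigmaRatio_isoInvariant : IotaIsoInvariant iotaSigmaRatio := by
  intro R T _ _ e f
  by_cases hR : IsLocalRing R
  · haveI : IsLocalRing T := e.isLocalRing
    rw [iotaSigmaRatio_eq, iotaSigmaRatio_eq, sigmaRatioNat_ringEquiv e f]
  · have hT : ¬ IsLocalRing T := fun hT => hR e.symm.isLocalRing
    rw [iotaSigmaRatio_of_not_isLocalRing R hR, iotaSigmaRatio_of_not_isLocalRing T hT]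

/-- (c6) for `σ₂`. -/
theorem iotaSigmaLevel_isoInvariant : IotaIsoInvariant iotaSigmaLevel := by
  intro R T _ _ e f
  by_cases hR : IsLocalRing R
  · haveI : IsLocalRing T := e.isLocalRing
    by_cases hb : BddAbove (levelSet f) ∧ (levelSet f).Nonempty
    · have hb' : BddAbove (levelSet (e f)) ∧ (levelSet (e f)).Nonempty := by rwa [levelSet_ringEquiv]
      rw [iotaSigmaLevel_eq R f hb, iotaSigmaLevel_eq T (e f) hb', sigmaLevelNat_ringEquiv e f]
    · have hb' : ¬ (BddAbove (levelSet (e f)) ∧ (levelSet (e f)).Nonempty) := by rwa [levelSet_ringEquiv]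
      rw [iotaSigmaLevel_eq_omega0 R f hb, iotaSigmaLevel_eq_omega0 T (e f) hb']
  · have hT : ¬ IsLocalRing T := fun hT => hR e.symm.isLocalRing
    rw [iotaSigmaLevel_of_not_isLocalRing R hR, iotaSigmaLevel_of_not_isLocalRing T hT]

/-- (c12a) for `σ₁`. -/
theorem iotaSigmaRatio_unitInvariant : IotaUnitInvariant iotaSigmaRatio := by
  intro R _ v f hv
  by_cases hR : IsLocalRing R
  · rw [iotaSigmaRatio_eq, iotaSigmaRatio_eq, sigmaRatioNat_unit_mul hv f]
  · rw [iotaSigmaRatio_of_not_isLocalRing R hR, iotaSigmaRatio_of_not_isLocalRing R hR]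

/-- (c12a) for `σ₂`. -/
theorem iotaSigmaLevel_unitInvariant : IotaUnitInvariant iotaSigmaLevel := by
  intro R _ v f hv
  by_cases hR : IsLocalRing R
  · by_cases hb : BddAbove (levelSet f) ∧ (levelSet f).Nonempty
    · have hb' : BddAbove (levelSet (v * f)) ∧ (levelSet (v * f)).Nonempty := by rwa [levelSet_unit_mul hv]
      rw [iotaSigmaLevel_eq R f hb, iotaSigmaLevel_eq R (v * f) hb', sigmaLevelNat_unit_mul hv f]
    · have hb' : ¬ (BddAbove (levelSet (v * f)) ∧ (levelSet (v * f)).Nonempty) := by rwa [levelSet_unit_mul hv]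
      rw [iotaSigmaLevel_eq_omega0 R f hb, iotaSigmaLevel_eq_omega0 R (v * f) hb']
  · rw [iotaSigmaLevel_of_not_isLocalRing R hR, iotaSigmaLevel_of_not_isLocalRing R hR]

/-- **(c6) for σ.** -/
theorem iotaSigma_isoInvariant : IotaIsoInvariant iotaSigma :=
  iotaLex_isoInvariant iotaSigmaRatio_isoInvariant iotaSigmaLevel_isoInvariant

/-- **(c12a) for σ.** -/
theorem iotaSigma_unitInvariant : IotaUnitInvariant iotaSigma :=
  iotaLex_unitInvariant iotaSigmaRatio_unitInvariant iotaSigmaLevel_unitInvariant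

/-- **(c6) for the nested candidate** `ι₃ = (ιε ; σ)`, from (c6) for the first block. -/
theorem iotaFlatOf_isoInvariant {ιε : (R : Type) → [CommRing R] → R → Ordinal.{0}} (hε : IotaIsoInvariant ιε) :
    IotaIsoInvariant (iotaFlatOf ιε) :=
  iotaLex_isoInvariant hε iotaSigma_isoInvariant

/-- **(c12a) for the nested candidate**, from (c12a) for the first block. -/
theorem iotaFlatOf_unitInvariant {ιε : (R : Type) → [CommRing R] → R → Ordinal.{0}} (hε : IotaUnitInvariant ιε) :
    IotaUnitInvariant (iotaFlatOf ιε) :=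
  iotaLex_unitInvariant hε iotaSigma_unitInvariant

/-- The nested candidate is `< ((ω+1)·ω)·Λ` when the first block is `< Λ` (so it can itself be nested further). -/
theorem iotaFlatOf_boundedBy {ιε : (R : Type) → [CommRing R] → R → Ordinal.{0}} {Λ : Ordinal.{0}}
    (hε : IotaBoundedBy Λ ιε) : IotaBoundedBy ((Ordinal.omega0 + 1) * Ordinal.omega0 * Λ) (iotaFlatOf ιε) :=
  iotaLex_boundedBy hε iotaSigma_boundedBy

end Iota3

end Summit.ResolutionOfSingularities.ResolutionOfSingularities.Cruxes.HypersurfaceCentreConstruction.LocalEngine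

end
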